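import Summits.QuantumFields.YangMills.Theorems.BalabanUVNodesN12TowerProxiesOfClass
import Literature.MathematicalPhysics.QuantumFieldTheory.Balaban1983to89.Node00.MultiScaleFibreChartB
import Literature.MathematicalPhysics.QuantumFieldTheory.Balaban1983to89.Node00.MultiScaleFibreChartCurvatureUniformB
import Literature.MathematicalPhysics.QuantumFieldTheory.Balaban1983to89.Node00.MultiScaleFibreChartLagrangeB
import Summits.QuantumFields.YangMills.Theorems.BalabanUVNodesN12ChartRegularityTowerProxiesB
import HarnessLib

/-!
# DAG node N12 [B15] — THE PER-BOND GUARDED PROXIES OF A (2.12)-CLASS CONFIGURATION (LOCATED-HSB repair pen ρ5b): every constrained bond `(j, c)` of `𝐁_k(Z)` admits a configuration — **BOND-DATUM EDITION** (`…N12TowerProxiesOfClassB`, USED DECLARATIONS ONLY)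

The print-datum ([Balaban1984PropagatorsII] (2.3)) (γ) twin of `Summits/…/Theorems/BalabanUVNodesN12TowerProxiesOfClass.lean`: the declarations of the parent whose STATEMENT reads the determining datum
(`chartLetters_msChart_Bj_of_isMinimizer_of_class`, `exists_lam_msChart_Bj_of_isMinimizer_regMSCoPOfRecord_of_class`, `towerProxies_Bj_of_mem_class`) and which N12's junction of record v14ᴸ uses (dag-n12-c g35 probe-2 census `UsedConstsN12RoadTyped2`, THEOREMS block), re-typed over a
BOND-LEVEL datum `𝔅 : BDetSet` (F0a `B15DeterminingSetsB`) and dag-n12-c's bond-datum chart `Node00.msChartB` (✓p774329; `msChart 𝐁 = msChartB (bondsDet 𝐁)` by `rfl`).  GENERATOR twin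
(this seat's `work/g32/gen_thm.py`, block-extracted from the parent's tree bytes): namespace `…N12TowerProxiesOfClassB`, SAME short names, `DetSet ↦ BDetSet`, `AgreeOn 𝐁 ↦ AgreeOnB 𝔅`,
`IsMinimizer ↦ IsMinimizerB`, `bondsOf (𝐁 j) ↦ 𝔅 j`, `msChart ∕ constrCard ∕ constrEnum ∕ ConstrSet ↦ …B`, NODE 00 chart lemmas `…msChart… ↦ …msChartB…`; proofs VERBATIM; the parent's
datum-free declarations REUSED BY NAME (`open`), never copied (private plumbing excepted, №366 R2).  The parent's (b) statements are the instances `𝔅 := bondsDet 𝐁`.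

Cell `pub-ymgap` (HUMAN RULINGS D-0062 ∕ D-0149), seat `pub-ymgap-dag-n12-d` g32 (R134 N12 [B15] s2; the (ii) Theorems-side re-key of N12's road at print's [II] (2.3) datum — director-ym №338 ∕
№343 (E1)(iii-b), FLAG №16 ∕ ruling (α); dag-n12-c DESIGN memo a793b2ebc0b803bf (ii); `N12-ROAD-TWIN-ORDER-2026-08-30.md`).  Count-neutral helper of K1⁹ `stmt-QuantumFields-27364`,
`--kind proof --supports … --as helper`.  THEOREMS ONLY (0 `def`, 0 `instance`, 0 `sorry`).

HONEST FRAMING (director-ym №338 (5)).  PURELY ADDITIVE: the parent stays landed and true on its own text; nothing in it is edited; no displayed premise of any consumer is deleted or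
weakened; every hypothesis of the parent stays a hypothesis.  Nothing of Bałaban's analysis asserted; N12 NOT discharged; K0⁷ ∕ K1⁹ NOT closed; counts unmoved (typed 28∕28 · discharged
8∕27, A 8∕28; K 1∕4); one finite 𝕋⁴ programme at fixed ε — R4 closes the conditional rung `BalabanLadder.UV` only; NOT the Yang–Mills mass gap (Clay); nothing continuum ∕ ℝ⁴ ∕ OS.

PARENT's DOCSTRING (the mathematics and the citations; read the site-level `𝐁` as the bond datum `𝔅`):
# DAG node N12 [B15] — THE PER-BOND GUARDED PROXIES OF A (2.12)-CLASS CONFIGURATION (LOCATED-HSB repair pen ρ5b): every constrained bond `(j, c)` of `𝐁_k(Z)` admits a configuration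
# `U′`, equal to `U₀` on the tower `feeds j c` and GLOBALLY small-below, as soon as `U₀` lies in the (2.12) class of record — an axial gauge on the tower box, read through the class at
# level `j − 1`, flattened off the box and gauged back; hence the direct road's chart letters and multiplier for a (2.12) minimiser WITHOUT the global `SmallBelow` letter

[Balaban1985Variational] = «[15]», (2) p. 278, Sect. C (44)–(48) p. 285, (81)–(83) p. 290; [Balaban1988Convergent] = «[III]», (2.2) p. 255, (2.10)–(2.13) pp. 256–257;
[Balaban1985Averaging] = «[B-Av]», (19) p. 21 (axial gauge); [Balaban1989LargeFieldII] (1.12) p. 359.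

Cell `pub-ymgap`, HUMAN RULINGS D-0062 ∕ D-0149, lane owner `pub-ymgap-dag-n12-c` (g21).  Key K1⁹ `stmt-QuantumFields-27364`, `--kind proof --supports … --as helper`; count-neutral.
NEW leaf; CONSUMED BY NAME, nothing modified: this lane's `N12ChartRegularityTowerProxies` (ρ5a), dag-n12-w6's `N12WindowNearRegionGeometry.boxPlaqs_subset_plaqsOf_topSeq_pred` ∕
`exists_word_endpoints` (the tower box lies in the class region one level down), dag-n21's `N21ReadSetSupport.feeds_witness` ∕ `within_lift_of_blockIter_eq` (the tower's fine bonds sit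
within `3Lʲ − 3` of the source centre), the tree's torus axial gauge `T4AxialGaugeSmallField.dist1_gaugeAct_axialGauge_le_of_mem_boxBonds`, dag-n12-w4's
`Node00.exists_nearFlat_eqOn` (flatten off a bond set) and `Node00.smallBelow_gaugeAct` (gauge invariance of the guard).

WHY.  ρ5a delivers the chart letters at `U₀` from ONE guarded proxy per constrained bond.  Here the proxies are PRODUCED from the class `U_k({Ω_j(Z)}, εreg)` alone: for a level-`j`
constrained bond `c` (`1 ≤ j ≤ k`, one end in `Γ_j ⊆ Ω_j^{(j)}`) every fine bond of `feeds j c` lies in the coordinate box of half-width `3Lʲ − 3` (+2) about `ι_j c₋`; that box is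
within `Lʲ + 3Lʲ` of a point of `Ω_j`, hence (for `4L ≤ M₁`) its plaquettes have a corner in the class's level-`(j−1)` set, where `U₀` is `εreg·η_{j−1}²`-plaquette-small; the torus
axial gauge of the box then makes `U₀` bondwise `(d−1)(6Lʲ−4)·εreg·η_{j−1}² ≤ 6(d−1)L·εreg`-near-flat on the box; flattening off the box gives a globally near-flat field, small-below
by the height's radius letter `hsbU` (`Node00.exists_uniform_chartCurvature_sq_bound`), and gauging back with the inverse axial gauge restores `U₀` on the box while keeping the guard
(`smallBelow_gaugeAct`).  At level `0` (`Γ₀ = Ω₁ᶜ`, `feeds 0 c = {c}`) a PURE GAUGE of the identity field does it.  No holonomy obstruction: each tower is its own box.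

CONTENTS (namespace `Summit.QuantumFields.YangMills.BalabanUVNodes.N12TowerProxiesOfClass`; theorems only — no `def`, no `instance`, no `sorry`).
* §1 arithmetic ∕ torus bookkeeping (`three_le_L` is `T4ReflectionCone`'s): `towerBox_lt_sitesPerDir`, `boxSide_mul_eta_sq_le`, `gaugeAct_inv_gaugeAct_eq`, `Within.add_right`, `shift_ne_self`.
* §2 ★ `feeds_subset_boxBonds` — the tower of a level-`j` bond lies in the coordinate box of half-width `3Lʲ − 3` (+2) about `ι_j c₋`.
* §3 ★★★ `exists_boxProxy_of_plaqSmallOn` (class-free core: ANY non-wrapping coordinate box on which `U₀` is plaquette-small, budget `(d−1)·n·δ ≤ ρ″` ⇒ `U′ = U₀` on the whole box,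
  `SmallBelow k U′` — the shape dag-n12-w6 asked for, per-bond and per-site boxes being instances), ★★★ `exists_boxProxy_of_mem_class` (box with corners in the class's level-`j′` set),
  ★★★ `exists_towerProxy_of_mem_class_pos` (levels `1 ≤ j ≤ k`), ★★ `exists_towerProxy_zero` (level `0`), ★★★ `towerProxies_Bj_of_mem_class` (ρ5a's hypothesis `hprox` at
  `𝐁 = 𝐁_k(Z)`, VERBATIM, from class membership + `4L ≤ M₁`, `k + 1 ≤ m + K`, `LᵏM₁ ∣ 2L^{m+K}`, the radius letter `hsbU` and ONE numeric floor `6(d−1)L·εreg ≤ ρ″`).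
* §4 ★★★ `exists_lam_msChart_Bj_of_isMinimizer_regMSCoPOfRecord_of_class`, ★★ `chartLetters_msChart_Bj_of_isMinimizer_of_class` — the direct chart rows' `hlam` and regularity
  binders for a (2.12) minimiser with NO `SmallBelow` hypothesis.

HONEST FRAMING ∕ LOCATED.  Lattice bookkeeping and kernel calculus over landed modules; the radius `ρ″` is an ∃-constant per height `(F, K, k)` (`exists_uniform_chartCurvature_sq_bound`,
displayed as the letter `hsbU`), the floor `6(d−1)L·εreg ≤ ρ″` a volume-free smallness condition on the class threshold; the three `hsb` consumers (chart rows p660018, (P4)′ p664681,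
(P5) p656421) are NOT re-keyed here (ρ5c); nothing of Bałaban's asserted; count-neutral helper; N12 NOT discharged; K1⁹ NOT closed; counts unmoved; one finite 𝕋⁴ programme at
fixed ε — R4 closes the conditional finite-𝕋⁴ rung `BalabanLadder.UV` only; NOT continuum ∕ OS ∕ mass gap ∕ Clay.
-/

noncomputable section

open scoped BigOperators Matrix.Norms.L2Operator Topology
open Filter Finset

namespace Summit.QuantumFields.YangMills.BalabanUVNodes.N12TowerProxiesOfClassB

open Literature.MathematicalPhysics.QuantumFieldTheory.Balaban1983to89.B15DeterminingSetsB

open Literature.MathematicalPhysics.QuantumFieldTheory.Balaban1983to89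
open T4Continuum (T4Family walkEnd)
open T4AdjointCovarianceUnitary (lieSU)
open B15DeterminingSets
open B14.Eq213MaximalDomains (side)
open B14.Eq213DetSet (Bj Bj_of_gt Bj_mid Bj_top maxDomT)
open B14.Eq216Concrete (feeds inputs iter_local feeds_zero)
open B14DomainGeom (Within)
open B15Eq112TorusCover (lift cover cover_lift cover_eq_cover_iff cover_add_pmul)
open B15LatticeCubeTorus (pmul)
open T4AxialGaugeSmallField (castSite boxPlaqs boxBonds axialGauge dist1_gaugeAct_axialGauge_le_of_mem_boxBonds)
open B7Prop1Explicit (e e_apply)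
open T4ReflectionCone (three_le_L)
open Node00
open Summit.QuantumFields.YangMills.BalabanUVNodes.N12ChartRegularityTowerProxiesB (chartLetters_msChart_of_towerProxies fibreChart_and_lam_msChart_of_towerProxies)
open Summit.QuantumFields.YangMills.BalabanUVNodes.N12WindowNearRegionGeometry (boxPlaqs_subset_plaqsOf_topSeq_pred exists_word_endpoints)
open Summit.QuantumFields.YangMills.Theorems.N21ReadSetSupport (feeds_witness within_lift_of_blockIter_eq blockIter_embIter)
open Summit.QuantumFields.YangMills.BalabanUVNodes.N12TowerProxiesOfClass (exists_towerProxy_of_mem_class_pos exists_towerProxy_zero)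

section
variable {F : T4Family} {N : ℕ} [NeZero N]

/-- ★★★ **THE PER-BOND PROXIES OF `𝐁_k(Z)` FROM THE CLASS** — ρ5a's hypothesis `hprox` at `𝐁 = 𝐁_k(Z)` VERBATIM: every constrained bond `(j_i, c_i)` admits `U′ = U₀` on `feeds j_i c_i`
with `SmallBelow k U′`, for `U₀` in the (2.12) class of record (`4L ≤ M₁`, `k + 1 ≤ m + K`, `LᵏM₁ ∣ 2L^{m+K}`, `0 ≤ εreg`, the radius letter `hsbU` and the floor `6(d−1)L·εreg ≤ ρ″`).
[cite: Balaban1985Variational, (2) p.278, (82)–(83) p.290; Balaban1988Convergent, (2.2) p.255, (2.11)–(2.13) pp.256–257] -/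
theorem towerProxies_lamBondsSeq_of_mem_class (ν : Stage7Numerics) (Kt : ℕ) {k : ℕ} (Z : Set (Site (F.P Kt) 0))
    (hkK : k + 1 ≤ (F.P Kt).m + (F.P Kt).K) (hM4 : 4 * (F.P Kt).L ≤ ν.M₁) (hdiv : side (F.P Kt).L ν.M₁ k ∣ (F.P Kt).sitesPerDir 0)
    (hε : 0 ≤ ν.εreg) {ρ'' : ℝ} (hsbU : ∀ V : GaugeField (F.P Kt) 0 (SU N), ‖coeField V - 1‖ ≤ ρ'' → SmallBelow (avOfRecord F N Kt) k V)
    (hερ : 6 * ((((F.P Kt).d - 1 : ℕ)) : ℝ) * (F.P Kt).L * ν.εreg ≤ ρ'')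
    {U₀ : GaugeField (F.P Kt) 0 (SU N)} (hU₀ : U₀ ∈ regMSCoPOfRecord F N ν Kt k (maxDomT ν.M₁ Z)) :
    ∀ i : Fin (constrCardB (lamBondsSeq (maxDomT ν.M₁ Z) k) k), ∃ U' : GaugeField (F.P Kt) 0 (SU N),
      (∀ b ∈ feeds (((constrEnumB (lamBondsSeq (maxDomT ν.M₁ Z) k) k).symm i).1 : ℕ) ((constrEnumB (lamBondsSeq (maxDomT ν.M₁ Z) k) k).symm i).2.1, U' b = U₀ b) ∧
        SmallBelow (avOfRecord F N Kt) k U' := by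
  intro i
  have key : ∀ j, j ≤ k → ∀ c : PBond (F.P Kt) j, c ∈ bondsOf (Bj ν.M₁ Z k j) →
      ∃ U' : GaugeField (F.P Kt) 0 (SU N), (∀ b ∈ feeds j c, U' b = U₀ b) ∧ SmallBelow (avOfRecord F N Kt) k U' := by
    intro j hj c hc
    rcases Nat.eq_zero_or_pos j with rfl | hj1
    · exact exists_towerProxy_zero Kt (by omega) (le_trans (by have := three_le_L (F.P Kt); positivity) hερ) hsbU U₀ c
    · exact exists_towerProxy_of_mem_class_pos ν Kt Z hkK hM4 hdiv hε hsbU hερ hU₀ hj1 hj hc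
  exact key _ (Nat.le_of_lt_succ ((constrEnumB (lamBondsSeq (maxDomT ν.M₁ Z) k) k).symm i).1.2) _ (lamBondsSeq_subset_bondsOf_genSet _ _ _ ((constrEnumB (lamBondsSeq (maxDomT ν.M₁ Z) k) k).symm i).2.2)

end

section
variable {F : T4Family} {N : ℕ} [NeZero N]

/-- ★★★ **THE MULTIPLIER `hlam` AT `𝐁_k(Z)` FOR A (2.12) MINIMISER WITH NO `SmallBelow` HYPOTHESIS** — `Node00.exists_lam_msChart_Bj_of_isMinimizer_regMSCoPOfRecord` with `hsb` DISCHARGED: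
per-bond proxies from the minimiser's own class (§3) fed to ρ5a.  Residual displayed rows: `4L ≤ M₁`, `k + 1 ≤ m + K`, the cube divisibility, `0 ≤ εreg`, the per-height radius letter
`hsbU` (∃ by `Node00.exists_uniform_chartCurvatureB_sq_bound`, before `ν`) and the volume-free floor `6(d−1)L·εreg ≤ ρ″`.
[cite: Balaban1985Variational, (82)–(83) p.290; Balaban1989LargeFieldII, (1.12) p.359; Balaban1988Convergent, (2.12)–(2.13) pp.256–257] -/
theorem exists_lam_msChart_lamBondsSeq_of_isMinimizer_regMSCoPOfRecord_of_class (ν : Stage7Numerics) (Kt : ℕ) {k : ℕ} (Z : Set (Site (F.P Kt) 0))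
    (hkK : k + 1 ≤ (F.P Kt).m + (F.P Kt).K) (hM4 : 4 * (F.P Kt).L ≤ ν.M₁) (hdiv : side (F.P Kt).L ν.M₁ k ∣ (F.P Kt).sitesPerDir 0)
    (hε : 0 ≤ ν.εreg) {ρ'' : ℝ} (hsbU : ∀ V : GaugeField (F.P Kt) 0 (SU N), ‖coeField V - 1‖ ≤ ρ'' → SmallBelow (avOfRecord F N Kt) k V)
    (hερ : 6 * ((((F.P Kt).d - 1 : ℕ)) : ℝ) * (F.P Kt).L * ν.εreg ≤ ρ'')
    {W : MSField (F.P Kt) (SU N)} {U₀ : GaugeField (F.P Kt) 0 (SU N)}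
    (h : IsMinimizerB (avOfRecord F N Kt) (regMSCoPOfRecord F N ν Kt k (maxDomT ν.M₁ Z)) (lamBondsSeq (maxDomT ν.M₁ Z) k) W U₀)
    (hsurj : Function.Surjective (fderiv ℝ (msChartB F N Kt k (lamBondsSeq (maxDomT ν.M₁ Z) k) W U₀) 0)) :
    ∃ lam : (Fin (constrCardB (lamBondsSeq (maxDomT ν.M₁ Z) k) k) → lieSU (Fin N)) →L[ℝ] ℝ,
      fderiv ℝ (fun Y : PBond (F.P Kt) 0 → lieSU (Fin N) => wilsonAction4 (expChart U₀ Y)) 0 = lam.comp (fderiv ℝ (msChartB F N Kt k (lamBondsSeq (maxDomT ν.M₁ Z) k) W U₀) 0) :=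
  (fibreChart_and_lam_msChart_of_towerProxies (by omega) h.2.1 (towerProxies_lamBondsSeq_of_mem_class ν Kt Z hkK hM4 hdiv hε hsbU hερ h.1)
    (fun _ hj => lamBondsSeq_of_gt _ _ hj) hsurj).2 (isCritOnFibreB_of_isMinimizerB_regMSCoPOfRecord ν (maxDomT ν.M₁ Z) h)

end

section
variable {F : T4Family} {N : ℕ} [NeZero N]

/-- ★★ **THE J-C REGULARITY LETTERS AT A (2.12) MINIMISER WITH NO `SmallBelow` HYPOTHESIS**: `C^∞` at `0`, the strict derivative, the pair `hΨ₂` ∕ `hΨd`, and the fibre clause of the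
canonical chart `Ψ_{𝐁_k(Z),W,U₀}` — ρ5a over §3. [cite: Balaban1985Variational, Sect. C p.285, (81)–(83) p.290; Balaban1988Convergent, (2.10)–(2.13) pp.256–257] -/
theorem chartLetters_msChart_lamBondsSeq_of_isMinimizer_of_class (ν : Stage7Numerics) (Kt : ℕ) {k : ℕ} (Z : Set (Site (F.P Kt) 0))
    (hkK : k + 1 ≤ (F.P Kt).m + (F.P Kt).K) (hM4 : 4 * (F.P Kt).L ≤ ν.M₁) (hdiv : side (F.P Kt).L ν.M₁ k ∣ (F.P Kt).sitesPerDir 0)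
    (hε : 0 ≤ ν.εreg) {ρ'' : ℝ} (hsbU : ∀ V : GaugeField (F.P Kt) 0 (SU N), ‖coeField V - 1‖ ≤ ρ'' → SmallBelow (avOfRecord F N Kt) k V)
    (hερ : 6 * ((((F.P Kt).d - 1 : ℕ)) : ℝ) * (F.P Kt).L * ν.εreg ≤ ρ'')
    {W : MSField (F.P Kt) (SU N)} {U₀ : GaugeField (F.P Kt) 0 (SU N)}
    (h : IsMinimizerB (avOfRecord F N Kt) (regMSCoPOfRecord F N ν Kt k (maxDomT ν.M₁ Z)) (lamBondsSeq (maxDomT ν.M₁ Z) k) W U₀) :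
    ContDiffAt ℝ ⊤ (msChartB F N Kt k (lamBondsSeq (maxDomT ν.M₁ Z) k) W U₀) 0 ∧
    HasStrictFDerivAt (msChartB F N Kt k (lamBondsSeq (maxDomT ν.M₁ Z) k) W U₀) (fderiv ℝ (msChartB F N Kt k (lamBondsSeq (maxDomT ν.M₁ Z) k) W U₀) 0) 0 ∧
    (HasFDerivAt (fun Y => fderiv ℝ (msChartB F N Kt k (lamBondsSeq (maxDomT ν.M₁ Z) k) W U₀) Y) (fderiv ℝ (fderiv ℝ (msChartB F N Kt k (lamBondsSeq (maxDomT ν.M₁ Z) k) W U₀)) 0) 0 ∧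
      ∀ᶠ Y in 𝓝 (0 : PBond (F.P Kt) 0 → lieSU (Fin N)), DifferentiableAt ℝ (msChartB F N Kt k (lamBondsSeq (maxDomT ν.M₁ Z) k) W U₀) Y) ∧
    (∀ᶠ X in 𝓝 (0 : PBond (F.P Kt) 0 → lieSU (Fin N)),
      msChartB F N Kt k (lamBondsSeq (maxDomT ν.M₁ Z) k) W U₀ X = msChartB F N Kt k (lamBondsSeq (maxDomT ν.M₁ Z) k) W U₀ 0 → AgreeOnB (lamBondsSeq (maxDomT ν.M₁ Z) k) (avgFamily (avOfRecord F N Kt) (expChart U₀ X)) W) := by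
  obtain ⟨h1, h2, h3, h4⟩ := chartLetters_msChart_of_towerProxies (by omega) h.2.1 (towerProxies_lamBondsSeq_of_mem_class ν Kt Z hkK hM4 hdiv hε hsbU hερ h.1)
  exact ⟨h1, h2, h3, h4 fun _ hj => lamBondsSeq_of_gt _ _ hj⟩

end

end Summit.QuantumFields.YangMills.BalabanUVNodes.N12TowerProxiesOfClassB

end
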